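import Summits.Ventures.KdS.RouteWRealAxisLattice
import Literature.Geometry.Lorentzian.KerrDeSitterPartialModeStabilityNonzeroFreq
import Literature.Geometry.Lorentzian.KerrDeSitterSuperradiantThresholds
import HarnessLib

/-!
# Venture KdS — Casals–Teixeira da Costa's Theorem 3.10 for EVERY spin, up to the fermionic
# superradiant-window clause: bullet 1 verbatim; the real-axis bullet under the window condition

HONEST FRAMING (venture `Summits/Ventures/KdS`, cell `pub-kds`, LIT-1 g23 under lead ruling A91, "T4"; file 2 of 2, file 1 = `RouteWRealAxisLattice.lean`). Nothing here is a
claim about the Final State Conjecture or about nonlinear stability. This file assembles LANDED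
theorems of the venture into the two bullets of the cited Literature fact
`CasalsTeixeiraDaCosta2022_theorem310` (`KerrDeSitterPartialModeStabilityNonzeroFreq.lean`, =
[CasalsTeixeiradacosta2022, Theorem 3.10] verbatim with Definition 3.4's standing `ω ≠ 0`), for
every `s ∈ ½ℤ`, and says exactly which printed clause is NOT covered.

WHAT IS PROVED (0 cited facts, 0 sorries):
* `pairCondition_p3` — Prop. 3.8's pair condition `p₃` for `−2(η₁+η₀)` holds on the closed upper
  half-plane for every subextremal `(M,a,Λ)` with `0 ≤ a` (`κ₁ < κ₀` for `a ≠ 0`,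
  `surfaceGravity_rPlus_lt_rMinus`; at `a = 0` the tree's `κ₀` and `η₀` vanish by `x/0 = 0`).
* `theorem310_bullet1` — **Theorem 3.10, first bullet, VERBATIM for every spin**: subextremal,
  `0 ≤ a`, `2s ∈ ℤ`, `Im ω > 0`, `Im(λ̄ω̄) ≤ 0`, `|ω| ∉ |m|(0,Ω_SR)`, and the generic-boundary regime's
  first disjunction `Re ω ≠ mϖ₁ ∨ s ≤ 0` ⟹ every generic-boundary radial Teukolsky solution vanishes
  on `(r₊, r_c)`. From `RouteW.prop38_allSpins` (@419021fd9474): `p₃` is `pairCondition_p3`, and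
  `p₁` (for `s − 2η₁`) is vacuous off the event threshold ray and not needed for `s ≤ 0 < 1`.
* `window_allSpins` — the Literature consequence `CasalsTeixeiraDaCosta2022_theorem310.window`
  with its fact binder removed (all other binders verbatim): a non-trivial mode has
  `0 < |ω| < |m|Ω_SR`.
* `realAxis_vanishing_halfInt`, `realAxis_vanishing_allSpins` — the real-axis bullet for every
  `s ≥ 1/2`, resp. every `s ∈ ½ℤ`, under `ω ∈ ℝ∖{0}`, `Im λ̄ = 0`, the window clause
  `m = 0 ∨ ω/m ∉ (Ω_low, Ω_SR)` and `Re ω ≠ mϖ₁ ∨ s ≤ 0` (for `s < 1`: the landed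
  `realAxis_vanishing_lt_one`; for `s ≥ 1`: `realAxis_vanishing_offLattice` /
  `realAxis_vanishing_lattice` of `RouteWRealAxisLattice.lean` — the spin flip is valid for every
  `ω`, and on the real axis the lattice is met only on its bottom stratum `j = s ∈ ℤ_{≥1}`).
* `theorem310_window` — the binder list of `CasalsTeixeiraDaCosta2022_theorem310` EXACTLY, except
  that in the real-axis disjunct the printed escape clause "`|s| ∈ {1/2, 3/2}`" is dropped (i.e. the
  window clause is imposed for every spin). PROVED.
* `theorem310_of_fermionicRealAxis` — the residual typed as an IMPLICATION into the Literature fact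
  by name (no new fact; the hypothesis is asserted nowhere): the fermionic clause ⟹
  `CasalsTeixeiraDaCosta2022_theorem310`.

WHAT IS NOT PROVED HERE (the precise residual of `CasalsTeixeiraDaCosta2022_theorem310_holds`): the
FERMIONIC SUPERRADIANT-WINDOW clause — `|s| ∈ {1/2, 3/2}`, `ω ∈ ℝ∖{0}`, `λ̄ ∈ ℝ`, `m ≠ 0`,
`ω/m ∈ (Ω_low, Ω_SR)`. Its printed proof is one sentence (arXiv v3 p. 17, proof of Thm 3.10, Step 1:
"By the same method [the Teukolsky–Starobinsky identities, [Tachizawa1993]], one may deduce that if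
`|s| ≤ 2` is half-integer, the energy identity implies that in fact `u ≡ 0` holds independently of
`ω`"); formalising it needs the local Teukolsky–Starobinsky constants of the flip at `r₊`, `r_c` and a
Wronskian with the time-reversed (conjugate) solution — not attempted in this file.
-/

noncomputable section

open Set Complex Filter Topology Finset Polynomial

namespace Summit.Ventures.KdS

namespace RouteW

open Literature.Analysis.ODE Literature.Analysis.ODE.GeneralHeun
open Literature.Geometry.Lorentzian Literature.Geometry.Lorentzian.KerrDeSitter
open SpinFlipTS

/-! ### Prop. 3.8's pair condition `p₃` is automatic for `0 ≤ a` -/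

/-- **`p₃` on the closed upper half-plane, every `0 ≤ a`.** `Re(−2(η₁+η₀)) = Im ω (1/κ₀ − 1/κ₁) ≤ 0`
since `κ₁ < κ₀` for `a ≠ 0` (`surfaceGravity_rPlus_lt_rMinus`); for `a = 0` the tree's `κ₀ = 0`, so
`Re η₀ = 0` and `Re(−2(η₁+η₀)) = −Im ω/κ₁ ≤ 0`. -/
theorem pairCondition_p3 {M a Λ : ℝ} (hsub : IsSubextremal M a Λ) (ha : 0 ≤ a) {ω : ℂ}
    (hω : 0 ≤ ω.im) (m : ℝ) :
    PairCondition (-2 * (etaEvent M a Λ ω m + etaCauchy M a Λ ω m)) := by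
  rcases eq_or_lt_of_le ha with ha0 | ha0
  · subst ha0
    intro _
    have hκ₁ := surfaceGravity_rPlus_pos hsub
    have hκ₀ : surfaceGravity M 0 Λ (rMinus M 0 Λ) = 0 := surfaceGravity_rMinus_zero_a hsub
    simp [Complex.mul_re, etaEvent_re, etaCauchy_re, hκ₀]
    have h1 : 0 ≤ ω.im / (2 * surfaceGravity M 0 Λ (rPlus M 0 Λ)) := by positivity
    linarith
  · exact pairCondition_eventCauchy' hsub ha0.ne' hω m

/-! ### Theorem 3.10, first bullet, verbatim, every spin -/

/-- **CTdC Theorem 3.10, bullet 1 (`Im ω > 0`), VERBATIM, for every `s ∈ ½ℤ` — PROVED, 0 cited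
facts.** On subextremal Kerr–de Sitter with `0 ≤ a`: `2s ∈ ℤ`, `Im ω > 0`, `Im(λ̄ω̄) ≤ 0`,
`|ω| ∉ |m|(0, Ω_SR)` and the generic-boundary regime's disjunction `Re ω ≠ mϖ₁ ∨ s ≤ 0` imply that
every classical radial Teukolsky solution on `(r₊, r_c)`, ingoing at `𝓗⁺` and outgoing at `𝓗⁺_c`
(generic bullets), vanishes identically. (`prop38_allSpins` with `p₃ = pairCondition_p3`; `p₁` is
vacuous off the event ray, `pairCondition_of_im_ne`, and unused for `s < 1`.)
[cite: CasalsTeixeiradacosta2022, Theorem 3.10 (first bullet)] -/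
theorem theorem310_bullet1 {M a Λ s : ℝ} {ω : ℂ} {m : ℝ} {lam : ℂ} {R : ℝ → ℂ}
    (hsub : IsSubextremal M a Λ) (ha : 0 ≤ a) (h2s : ∃ k : ℤ, 2 * s = k) (hω : 0 < ω.im)
    (hlam : (lambdaBar a Λ s ω m lam * (starRingEnd ℂ) ω).im ≤ 0)
    (hSR : ¬(0 < ‖ω‖ ∧ ‖ω‖ < |m| * superradiantUpper M a Λ))
    (h1 : ω.re ≠ m * horizonAngVel a (rPlus M a Λ) ∨ s ≤ 0)
    (hR : IsRadialTeukolskySolution M a Λ s ω m lam R) (hin : IsIngoingAtEventHorizon M a Λ s ω m R)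
    (hout : IsOutgoingAtCosmoHorizon M a Λ ω m R) :
    ∀ r ∈ Ioo (rPlus M a Λ) (rCosmo M a Λ), R r = 0 := by
  have hp₃ := pairCondition_p3 hsub ha hω.le m
  rcases h1 with hray | hs0
  · have hκ₁ := surfaceGravity_rPlus_pos hsub
    have hp₁ : PairCondition ((s : ℂ) - 2 * etaEvent M a Λ ω m) := by
      refine pairCondition_of_im_ne ?_
      have him : ((s : ℂ) - 2 * etaEvent M a Λ ω m).im =
          (ω.re - m * horizonAngVel a (rPlus M a Λ)) / surfaceGravity M a Λ (rPlus M a Λ) := by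
        simp [etaEvent_im]
        field_simp
      rw [him]
      exact div_ne_zero (sub_ne_zero.mpr hray) hκ₁.ne'
    exact prop38_allSpins M a Λ s ω m lam hsub ha h2s hω hlam hSR hp₁ hp₃ R hR hin hout
  · exact radial_vanishing_lt_one hsub ha (by linarith) hω hlam hSR hp₃ hR hin hout

/-- **Bullet 1's Literature consequence, fact-free.** The statement of
`CasalsTeixeiraDaCosta2022_theorem310.window` (`KerrDeSitterPartialModeStabilityNonzeroFreq.lean`)
with its first binder `(h : CasalsTeixeiraDaCosta2022_theorem310)` REMOVED and every other binder
kept verbatim and in order: a non-trivial generic-regime mode with `Im ω > 0`, `Im(λ̄ω̄) ≤ 0` has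
`0 < |ω| < |m|·Ω_SR`, for every `s ∈ ½ℤ`. [cite: CasalsTeixeiradacosta2022, Theorem 3.10 (first bullet)] -/
theorem window_allSpins {M a Λ s : ℝ} {ω : ℂ} {m : ℝ} {lam : ℂ}
    (hsub : IsSubextremal M a Λ) (ha : 0 ≤ a) (_haL : |a| < 3 / Λ) (_haL2 : a ^ 2 < 3 / Λ)
    (hs : ∃ k : ℤ, 2 * s = k)
    (_hm : ∃ k : ℤ, m - s = k) (hω : 0 < ω.im)
    (hlam : (lambdaBar a Λ s ω m lam * (starRingEnd ℂ) ω).im ≤ 0)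
    (h1 : ω.re ≠ m * horizonAngVel a (rPlus M a Λ) ∨ s ≤ 0)
    (_h2 : ω.re ≠ m * horizonAngVel a (rCosmo M a Λ) ∨ 0 ≤ s) {R : ℝ → ℂ}
    (hR : IsRadialTeukolskySolution M a Λ s ω m lam R) (hin : IsIngoingAtEventHorizon M a Λ s ω m R)
    (hout : IsOutgoingAtCosmoHorizon M a Λ ω m R) (hnt : ∃ r ∈ Ioo (rPlus M a Λ) (rCosmo M a Λ), R r ≠ 0) :
    0 < ‖ω‖ ∧ ‖ω‖ < |m| * superradiantUpper M a Λ := by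
  by_contra hw
  obtain ⟨r, hr, hne⟩ := hnt
  exact hne (theorem310_bullet1 hsub ha hs hω hlam hw h1 hR hin hout r hr)

/-! ### The real-axis bullet under the window clause, every spin -/

/-- **Real axis, every `s ≥ 1/2`, window clause.** For `s = N/2 ≥ 1/2`, `ω ∈ ℝ∖{0}`, `Im λ̄ = 0`,
`m = 0 ∨ ω/m ∉ (Ω_low, Ω_SR)` and `Re ω ≠ mϖ₁`: `R ≡ 0` (off the lattice:
`realAxis_vanishing_offLattice`; on it, real parts give `j = s` and `realAxis_vanishing_lattice`
applies). [cite: CasalsTeixeiradacosta2022, Theorem 3.10 (second bullet)] -/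
theorem realAxis_vanishing_halfInt {M a Λ s : ℝ} {ω : ℂ} {m : ℝ} {lam : ℂ} {R : ℝ → ℂ}
    (hsub : IsSubextremal M a Λ) (ha : 0 ≤ a) {N : ℕ} (hN1 : 1 ≤ N) (hsN : 2 * s = N)
    (hω : ω.im = 0) (hω0 : ω ≠ 0) (hlam : (lambdaBar a Λ s ω m lam).im = 0)
    (hthird : m = 0 ∨
      ¬(superradiantLower M a Λ < ω.re / m ∧ ω.re / m < superradiantUpper M a Λ))
    (hray : ω.re ≠ m * horizonAngVel a (rPlus M a Λ))
    (hR : IsRadialTeukolskySolution M a Λ s ω m lam R) (hin : IsIngoingAtEventHorizon M a Λ s ω m R)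
    (hout : IsOutgoingAtCosmoHorizon M a Λ ω m R) :
    ∀ r ∈ Ioo (rPlus M a Λ) (rCosmo M a Λ), R r = 0 := by
  by_cases hoff : OffLattice M a Λ s ω m
  · exact realAxis_vanishing_offLattice hsub ha hN1 hsN hω hω0 hlam hthird hoff hR hin hout
  obtain ⟨j, hj, hj'⟩ : ∃ j : ℤ, (j : ℝ) ≤ 2 * s - 1 ∧
      (s : ℂ) + 2 * horizonB M a Λ ω m (rCosmo M a Λ) = j := by
    by_contra h
    exact hoff fun j hj hj' => h ⟨j, hj, hj'⟩
  -- real parts: `Re B(r_c) = −Re η₂ = 0`, so `j = s`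
  have hre := congrArg Complex.re hj'
  rw [horizonB_rCosmo_eq_neg_etaCosmo hsub] at hre
  simp [etaCosmo_re, hω] at hre
  -- so `s = j ≥ 1`, `j + 1 ≤ 2s = N`
  have hN' : (1 : ℝ) ≤ N := by exact_mod_cast hN1
  have hj1 : (1 : ℝ) ≤ j := by linarith
  have hj0 : (0 : ℤ) ≤ j := by exact_mod_cast (show (0 : ℝ) ≤ j by linarith)
  obtain ⟨j₀, hj₀⟩ : ∃ j₀ : ℕ, (j₀ : ℤ) = j := ⟨j.toNat, Int.toNat_of_nonneg hj0⟩
  have hj₀r : (j₀ : ℝ) = (j : ℝ) := by rw [← hj₀]; norm_cast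
  have hj₀N : j₀ + 1 ≤ N := by
    have h2 : (j₀ : ℝ) + 1 ≤ (N : ℝ) := by rw [hj₀r]; linarith
    exact_mod_cast h2
  have hlat : (s : ℂ) + 2 * horizonB M a Λ ω m (rCosmo M a Λ) = (j₀ : ℂ) := by
    rw [hj']
    have : ((j : ℤ) : ℂ) = ((j₀ : ℕ) : ℂ) := by rw [← hj₀]; norm_cast
    exact this
  exact realAxis_vanishing_lattice hsub ha hN1 hsN hω hω0 hlam hthird hray hj₀N hlat hR hin hout

/-- **CTdC Theorem 3.10, real-axis bullet, under the window clause, for EVERY `s ∈ ½ℤ` — PROVED,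
0 cited facts.** Subextremal, `0 ≤ a`, `2s ∈ ℤ`, `ω ∈ ℝ∖{0}`, `Im λ̄ = 0`,
`m = 0 ∨ ω/m ∉ (Ω_low, Ω_SR)`, `Re ω ≠ mϖ₁ ∨ s ≤ 0` ⟹ every generic-boundary radial Teukolsky solution
vanishes on `(r₊, r_c)` (`s < 1`: `realAxis_vanishing_lt_one`; `s ≥ 1`: `realAxis_vanishing_halfInt`).
[cite: CasalsTeixeiradacosta2022, Theorem 3.10 (second bullet)] -/
theorem realAxis_vanishing_allSpins {M a Λ s : ℝ} {ω : ℂ} {m : ℝ} {lam : ℂ} {R : ℝ → ℂ}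
    (hsub : IsSubextremal M a Λ) (ha : 0 ≤ a) (h2s : ∃ k : ℤ, 2 * s = k)
    (hω : ω.im = 0) (hω0 : ω ≠ 0) (hlam : (lambdaBar a Λ s ω m lam).im = 0)
    (hthird : m = 0 ∨
      ¬(superradiantLower M a Λ < ω.re / m ∧ ω.re / m < superradiantUpper M a Λ))
    (h1 : ω.re ≠ m * horizonAngVel a (rPlus M a Λ) ∨ s ≤ 0)
    (hR : IsRadialTeukolskySolution M a Λ s ω m lam R) (hin : IsIngoingAtEventHorizon M a Λ s ω m R)
    (hout : IsOutgoingAtCosmoHorizon M a Λ ω m R) :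
    ∀ r ∈ Ioo (rPlus M a Λ) (rCosmo M a Λ), R r = 0 := by
  by_cases hs : s < 1
  · exact realAxis_vanishing_lt_one hsub ha hs hω hω0 hlam hthird hR hin hout
  have hray : ω.re ≠ m * horizonAngVel a (rPlus M a Λ) := by
    rcases h1 with h | h
    · exact h
    · exact absurd h (by linarith)
  obtain ⟨k, hk⟩ := h2s
  have hk1 : (1 : ℤ) ≤ k := by
    have : (1 : ℝ) ≤ (k : ℝ) := by rw [← hk]; linarith
    exact_mod_cast this
  obtain ⟨N, hNk⟩ : ∃ N : ℕ, (N : ℤ) = k := ⟨k.toNat, Int.toNat_of_nonneg (by omega)⟩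
  have hsN : 2 * s = (N : ℝ) := by
    rw [hk]; exact_mod_cast hNk.symm
  have hN1 : 1 ≤ N := by exact_mod_cast (hNk ▸ hk1 : (1 : ℤ) ≤ (N : ℤ))
  exact realAxis_vanishing_halfInt hsub ha hN1 hsN hω hω0 hlam hthird hray hR hin hout

/-! ### Theorem 3.10 with the window clause imposed for every spin -/

/-- **CTdC Theorem 3.10 (with Definition 3.4's `ω ≠ 0`) for every `s ∈ ½ℤ`, window clause for
all spins — PROVED, 0 cited facts.** Literally the binder list of the Literature fact
`CasalsTeixeiraDaCosta2022_theorem310` with ONE change: in the real-axis disjunct the printed escape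
"`2|s| ∈ {1, 3}`" (no window condition for `|s| = 1/2, 3/2`) is removed. The omitted clause — the
fermionic superradiant window — is the exact residual of `CasalsTeixeiraDaCosta2022_theorem310_holds`
(module docstring). The binders `|a| < 3/Λ`, `a² < 3/Λ`, `m − s ∈ ℤ` and the second regime
disjunction are not used. [cite: CasalsTeixeiradacosta2022, Theorem 3.10 with Definition 3.4] -/
theorem theorem310_window (M a Λ s : ℝ) (ω : ℂ) (m : ℝ) (lam : ℂ) (hsub : IsSubextremal M a Λ)
    (ha : 0 ≤ a) (_haL : |a| < 3 / Λ) (_haL2 : a ^ 2 < 3 / Λ) (h2s : ∃ k : ℤ, 2 * s = k)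
    (_hm : ∃ k : ℤ, m - s = k) (hω0 : ω ≠ 0)
    (hb : (0 < ω.im ∧ (lambdaBar a Λ s ω m lam * (starRingEnd ℂ) ω).im ≤ 0 ∧
        ¬(0 < ‖ω‖ ∧ ‖ω‖ < |m| * superradiantUpper M a Λ)) ∨
      (ω.im = 0 ∧ (lambdaBar a Λ s ω m lam).im = 0 ∧
        (m = 0 ∨ ¬(superradiantLower M a Λ < ω.re / m ∧ ω.re / m < superradiantUpper M a Λ))))
    (h1 : ω.re ≠ m * horizonAngVel a (rPlus M a Λ) ∨ s ≤ 0)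
    (_h2 : ω.re ≠ m * horizonAngVel a (rCosmo M a Λ) ∨ 0 ≤ s)
    (R : ℝ → ℂ) (hR : IsRadialTeukolskySolution M a Λ s ω m lam R)
    (hin : IsIngoingAtEventHorizon M a Λ s ω m R) (hout : IsOutgoingAtCosmoHorizon M a Λ ω m R) :
    ∀ r ∈ Ioo (rPlus M a Λ) (rCosmo M a Λ), R r = 0 := by
  rcases hb with ⟨hω, hlam, hSR⟩ | ⟨hω, hlam, hthird⟩
  · exact theorem310_bullet1 hsub ha h2s hω hlam hSR h1 hR hin hout
  · exact realAxis_vanishing_allSpins hsub ha h2s hω hω0 hlam hthird h1 hR hin hout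

/-- **The residual, typed as an implication (no new fact).** IF the fermionic superradiant-window
clause holds — `|s| ∈ {1/2, 3/2}`, `ω ∈ ℝ∖{0}`, `Im λ̄ = 0`, generic regime ⟹ `R ≡ 0`, with no window
condition — THEN the cited fact `CasalsTeixeiraDaCosta2022_theorem310` holds outright. This only
documents what `_holds` still needs; the hypothesis is NOT asserted anywhere in the tree.
[cite: CasalsTeixeiradacosta2022, Theorem 3.10 (second bullet, |s| = 1/2, 3/2)] -/
theorem theorem310_of_fermionicRealAxis
    (hF : ∀ (M a Λ s : ℝ) (ω : ℂ) (m : ℝ) (lam : ℂ), IsSubextremal M a Λ → 0 ≤ a →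
      (∃ k : ℤ, 2 * |s| = k ∧ (k = 1 ∨ k = 3)) → ω ≠ 0 → ω.im = 0 →
      (lambdaBar a Λ s ω m lam).im = 0 →
      (ω.re ≠ m * horizonAngVel a (rPlus M a Λ) ∨ s ≤ 0) →
      (ω.re ≠ m * horizonAngVel a (rCosmo M a Λ) ∨ 0 ≤ s) →
      ∀ R : ℝ → ℂ, IsRadialTeukolskySolution M a Λ s ω m lam R →
        IsIngoingAtEventHorizon M a Λ s ω m R → IsOutgoingAtCosmoHorizon M a Λ ω m R →
          ∀ r ∈ Ioo (rPlus M a Λ) (rCosmo M a Λ), R r = 0) :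
    CasalsTeixeiraDaCosta2022_theorem310 := by
  intro M a Λ s ω m lam hsub ha haL haL2 h2s hm hω0 hb h1 h2 R hR hin hout
  rcases hb with ⟨hω, hlam, hSR⟩ | ⟨hω, hlam, hsr⟩
  · exact theorem310_bullet1 hsub ha h2s hω hlam hSR h1 hR hin hout
  · rcases hsr with hferm | hm0 | hwin
    · exact hF M a Λ s ω m lam hsub ha hferm hω0 hω hlam h1 h2 R hR hin hout
    · exact realAxis_vanishing_allSpins hsub ha h2s hω hω0 hlam (Or.inl hm0) h1 hR hin hout
    · exact realAxis_vanishing_allSpins hsub ha h2s hω hω0 hlam (Or.inr hwin) h1 hR hin hout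

/-! ### Statement identities for the referee -/

/-- The residual reduction targets the Literature fact BY NAME (no restatement in this file). -/
example (hF : ∀ (M a Λ s : ℝ) (ω : ℂ) (m : ℝ) (lam : ℂ), IsSubextremal M a Λ → 0 ≤ a →
      (∃ k : ℤ, 2 * |s| = k ∧ (k = 1 ∨ k = 3)) → ω ≠ 0 → ω.im = 0 →
      (lambdaBar a Λ s ω m lam).im = 0 →
      (ω.re ≠ m * horizonAngVel a (rPlus M a Λ) ∨ s ≤ 0) →
      (ω.re ≠ m * horizonAngVel a (rCosmo M a Λ) ∨ 0 ≤ s) →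
      ∀ R : ℝ → ℂ, IsRadialTeukolskySolution M a Λ s ω m lam R →
        IsIngoingAtEventHorizon M a Λ s ω m R → IsOutgoingAtCosmoHorizon M a Λ ω m R →
          ∀ r ∈ Ioo (rPlus M a Λ) (rCosmo M a Λ), R r = 0) :
    Literature.Geometry.Lorentzian.KerrDeSitter.CasalsTeixeiraDaCosta2022_theorem310 :=
  theorem310_of_fermionicRealAxis hF

/-- `window_allSpins` has the type of the Literature consequence `….theorem310.window` fed with ANY
proof of the fact — i.e. the same statement with the fact binder discharged. -/
example (h : CasalsTeixeiraDaCosta2022_theorem310) {M a Λ s : ℝ} {ω : ℂ} {m : ℝ} {lam : ℂ}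
    (hsub : IsSubextremal M a Λ) (ha : 0 ≤ a) (haL : |a| < 3 / Λ) (haL2 : a ^ 2 < 3 / Λ)
    (hs : ∃ k : ℤ, 2 * s = k) (hm : ∃ k : ℤ, m - s = k) (hω : 0 < ω.im)
    (hlam : (lambdaBar a Λ s ω m lam * (starRingEnd ℂ) ω).im ≤ 0)
    (h1 : ω.re ≠ m * horizonAngVel a (rPlus M a Λ) ∨ s ≤ 0)
    (h2 : ω.re ≠ m * horizonAngVel a (rCosmo M a Λ) ∨ 0 ≤ s) {R : ℝ → ℂ}
    (hR : IsRadialTeukolskySolution M a Λ s ω m lam R) (hin : IsIngoingAtEventHorizon M a Λ s ω m R)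
    (hout : IsOutgoingAtCosmoHorizon M a Λ ω m R)
    (hnt : ∃ r ∈ Ioo (rPlus M a Λ) (rCosmo M a Λ), R r ≠ 0) :
    (h.window hsub ha haL haL2 hs hm hω hlam h1 h2 hR hin hout hnt :
      0 < ‖ω‖ ∧ ‖ω‖ < |m| * superradiantUpper M a Λ) =
    window_allSpins hsub ha haL haL2 hs hm hω hlam h1 h2 hR hin hout hnt := rfl

end RouteW

end Summit.Ventures.KdS

end
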